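import Literature.AnabelianGeometry.SemiGraphs.TreeFixedPairProofs
import Literature.AnabelianGeometry.SemiGraphs.InverseSystemEventuallySingleton

/-!
# Fixed closed edges in a system of trees ([SemiAnbd] Thm. 3.7 (iii), Comments (6)(b))

Mochizuki, *Semi-graphs of Anabelioids*, Publ. RIMS **42** (2006) 221–322, Theorem 3.7 (iii)
[cite: MochizukiSemiAnbd2006, Thm. 3.7(iii) p.41], in the form of the author's *Comments* (May 2020),
item (6)(b): with `V_i`, `E_i` the sets of `H`-fixed vertices and CLOSED edges of the trees
`𝒢_{i,∞}`, "Suppose that for some cofinal subset `J ⊆ I`, we have `#V_j ≥ 2`, for all `j ∈ J`.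
Then it follows from Lemma 1.8, (ii), (b), that `#E_j ≥ 1`, for all `j ∈ J` … it follows from
(∗_j) that each of the nonempty sets `E_{j,i}` … is of cardinality 1 … Thus, the unique elements of
the `E_{j,∞}` form a compatible system of closed edges fixed by `H`."

This proof-only file is the tree-level (no anabelioids) core of that case, instantiating the
inverse-system lemma `InverseSystemEventuallySingleton.exists_compatible_of_eventually_subsingleton_image`:

* `isClosedEdge_edgeMap` — a morphism of semi-graphs maps closed edges to closed edges;
* `exists_fixed_closedEdge_of_two_fixed_vertices` — "`#V_j ≥ 2 ⇒ #E_j ≥ 1`": a group fixing two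
  distinct vertices of a tree fixes a closed edge (the first edge of the fixed geodesic);
* `exists_compatible_fixed_closedEdges_of_hstar` — for a directed system of trees with actions of
  a group `P` and equivariant transition morphisms, if `C ≤ P` fixes two distinct vertices at
  every level and condition (∗) holds (`hstar`: above every level some transition map identifies
  all `C`-fixed closed edges), then there is a compatible system of `C`-fixed closed edges.
-/

namespace Literature.AnabelianGeometry.SemiGraphs

namespace SemiGraph

open CategoryTheory

universe u v w

/-! ### Closed edges under morphisms -/

/-- A closed edge has two distinct branches abutting to vertices.
[cite: MochizukiSemiAnbd2006, §1 p.11] -/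
theorem exists_branches_of_isClosedEdge {G : SemiGraph.{u}} {e : G.Edge} (he : G.IsClosedEdge e) :
    ∃ (c c' : G.Branch) (w w' : G.Vertex), c ≠ c' ∧ G.edgeOf c = e ∧ G.edgeOf c' = e ∧
      G.abuts c = some w ∧ G.abuts c' = some w' := by
  unfold IsClosedEdge vertCard at he
  obtain ⟨x, y, hxy, -⟩ := Nat.card_eq_two_iff.mp he
  obtain ⟨w, hw⟩ := Option.isSome_iff_exists.mp x.2.2
  obtain ⟨w', hw'⟩ := Option.isSome_iff_exists.mp y.2.2
  exact ⟨x.1, y.1, w, w', fun h => hxy (Subtype.ext h), x.2.1, y.2.1, hw, hw'⟩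

/-- A morphism of semi-graphs maps closed edges to closed edges (it is injective on the branches
of an edge and preserves abutment). [cite: MochizukiSemiAnbd2006, §1 p.11] -/
theorem isClosedEdge_edgeMap {G H : SemiGraph.{u}} (φ : G ⟶ H) {e : G.Edge}
    (he : G.IsClosedEdge e) : H.IsClosedEdge (φ.edgeMap e) := by
  obtain ⟨c, c', w, w', hcc, hce, hc'e, hcw, hc'w⟩ := exists_branches_of_isClosedEdge he
  refine isClosedEdge_of_abuts (c := φ.branchMap c) (c' := φ.branchMap c')
    (fun h => hcc (φ.branchMap_injOn c c' (hce.trans hc'e.symm) h)) ?_ ?_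
    (φ.abuts_branchMap c w hcw) (φ.abuts_branchMap c' w' hc'w)
  · rw [φ.edgeOf_branchMap, hce]
  · rw [φ.edgeOf_branchMap, hc'e]

/-! ### Two fixed vertices give a fixed closed edge -/

/-- **"`#V_j ≥ 2 ⇒ #E_j ≥ 1`"** (Comments (6)(b), via Lemma 1.8 (ii)(b)): if a group acting on a
tree fixes two distinct vertices, it fixes a closed edge — the first edge of the geodesic between
them, which is fixed pointwise. [cite: MochizukiSemiAnbd2006, Lem. 1.8(ii)(b) p.20] -/
theorem exists_fixed_closedEdge_of_two_fixed_vertices {G : SemiGraph.{u}} (hG : G.IsTree)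
    {Γ : Type w} [Group Γ] (ρ : Γ →* Aut G) {w₁ w₂ : G.Vertex} (hne : w₁ ≠ w₂)
    (hw₁ : ∀ γ, (ρ γ).hom.vertexMap w₁ = w₁) (hw₂ : ∀ γ, (ρ γ).hom.vertexMap w₂ = w₂) :
    ∃ e : G.Edge, G.IsClosedEdge e ∧ ∀ γ, (ρ γ).hom.edgeMap e = e := by
  have hA : G.subdivision.IsAcyclic := hG.isTree.isAcyclic
  obtain ⟨p, hp⟩ := hG.isTree.connected.exists_isPath (Sum.inl w₁) (Sum.inl w₂)
  -- all nodes of the geodesic are fixed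
  have hfix : ∀ z ∈ p.support, ∀ γ, nodeMap (ρ γ) z = z := fun z hz γ =>
    nodeMap_eq_self_of_isPath hA (ρ γ) (by simp [hw₁ γ]) (by simp [hw₂ γ]) p hp z hz
  -- walk along: `w₁ – c₁ – e – c₂ – v`
  set n := p.length with hn
  have hx0 : p.getVert 0 = Sum.inl w₁ := p.getVert_zero
  have hxn : p.getVert n = Sum.inl w₂ := p.getVert_length
  have hw12 : (Sum.inl w₁ : G.Node) ≠ Sum.inl w₂ := by simpa using hne
  have h0 : 0 < n := lt_length_of_getVert_ne p (Nat.zero_le _) (by rw [hx0]; exact hw12)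
  obtain ⟨c₁, hc₁w, hx1⟩ := step_vertex p h0 hx0
  have h1 : 1 < n := lt_length_of_getVert_ne p h0 (by rw [hx1]; simp)
  -- node 2 is the edge of `c₁` (not `w₁` again)
  have hx2 : p.getVert 2 = Sum.inr (Sum.inl (G.edgeOf c₁)) := by
    rcases step_branch p h1 hx1 with h | ⟨v, hv, h⟩
    · exact h
    · exfalso
      rw [hc₁w] at hv
      have hvw : v = w₁ := (Option.some.inj hv).symm
      rw [hvw] at h
      exact getVert_add_two_ne p hp (i := 0) (by omega) (h.trans hx0.symm)
  set e := G.edgeOf c₁ with he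
  have h2 : 2 < n := lt_length_of_getVert_ne p (by omega) (by rw [hx2]; simp)
  obtain ⟨c₂, hc₂e, hx3⟩ := step_edge p h2 hx2
  have hc₁₂ : c₁ ≠ c₂ := by
    intro h
    rw [← h] at hx3
    exact getVert_add_two_ne p hp (i := 1) (by omega) (hx3.trans hx1.symm)
  have h3 : 3 < n := lt_length_of_getVert_ne p (by omega) (by rw [hx3]; simp)
  -- node 4 is a vertex `v` with `c₂` abutting to it (not the edge `e` again)
  obtain ⟨v, hc₂v⟩ : ∃ v : G.Vertex, G.abuts c₂ = some v := by
    rcases step_branch p h3 hx3 with h | ⟨v, hv, -⟩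
    · exfalso
      rw [hc₂e] at h
      exact getVert_add_two_ne p hp (i := 2) (by omega) (h.trans hx2.symm)
    · exact ⟨v, hv⟩
  refine ⟨e, isClosedEdge_of_abuts hc₁₂ rfl hc₂e hc₁w hc₂v, fun γ => ?_⟩
  have h := hfix _ (hx2 ▸ p.getVert_mem_support 2) γ
  simpa using h

/-! ### Compatible systems of fixed closed edges from condition (∗) -/

/-- **Comments (6)(b) at tree level**: a directed system of trees `T_j` with actions `ρ_j` of a
group `P` and `P`-equivariant transition morphisms `f`; if the subgroup `C` fixes two distinct
vertices of every `T_j`, and condition (∗) holds — above every level `j` there is `i ≥ j` such that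
all `C`-fixed closed edges of `T_i` have the same image in `T_j` —, then there is a compatible
system of `C`-fixed closed edges. [cite: MochizukiSemiAnbd2006, Thm. 3.7(iii) p.41] -/
theorem exists_compatible_fixed_closedEdges_of_hstar {P : Type w} [Group P] (C : Subgroup P)
    {J : Type v} [Preorder J] [IsDirectedOrder J] (T : J → SemiGraph.{u})
    (hT : ∀ j, (T j).IsTree) (ρ : ∀ j, P →* Aut (T j)) (f : ∀ ⦃i j : J⦄, i ≤ j → (T j ⟶ T i))
    (f_comp : ∀ ⦃i j k : J⦄ (hij : i ≤ j) (hjk : j ≤ k), f hjk ≫ f hij = f (hij.trans hjk))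
    (hfe : ∀ ⦃i j : J⦄ (h : i ≤ j) (g : P), (ρ j g).hom ≫ f h = f h ≫ (ρ i g).hom)
    (htwo : ∀ j, ∃ w₁ w₂ : (T j).Vertex, w₁ ≠ w₂ ∧ (∀ γ : C, (ρ j γ).hom.vertexMap w₁ = w₁) ∧
      ∀ γ : C, (ρ j γ).hom.vertexMap w₂ = w₂)
    (hstar : ∀ j, ∃ (i : J) (h : j ≤ i), ∀ e e' : (T i).Edge,
      (T i).IsClosedEdge e → (T i).IsClosedEdge e' → (∀ γ : C, (ρ i γ).hom.edgeMap e = e) →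
        (∀ γ : C, (ρ i γ).hom.edgeMap e' = e') → (f h).edgeMap e = (f h).edgeMap e') :
    ∃ ε : ∀ j, (T j).Edge,
      (∀ j, (T j).IsClosedEdge (ε j) ∧ ∀ γ : C, (ρ j γ).hom.edgeMap (ε j) = ε j) ∧
      ∀ ⦃i j : J⦄ (h : i ≤ j), (f h).edgeMap (ε j) = ε i := by
  -- the `C`-fixed closed edges, as a `φ`-stable family of nonempty sets
  let F : ∀ j, Set (T j).Edge := fun j =>
    {e | (T j).IsClosedEdge e ∧ ∀ γ : C, (ρ j γ).hom.edgeMap e = e}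
  have hne : ∀ j, (F j).Nonempty := fun j => by
    obtain ⟨w₁, w₂, hw, hw₁, hw₂⟩ := htwo j
    obtain ⟨e, he, hfe⟩ := exists_fixed_closedEdge_of_two_fixed_vertices (hT j)
      ((ρ j).comp C.subtype) hw hw₁ hw₂
    exact ⟨e, he, hfe⟩
  have hmap : ∀ ⦃i j : J⦄ (h : i ≤ j) (x : (T j).Edge), x ∈ F j → (f h).edgeMap x ∈ F i := by
    intro i j h x hx
    refine ⟨isClosedEdge_edgeMap (f h) hx.1, fun γ => ?_⟩
    have e1 := congrArg (fun φ : T j ⟶ T i => φ.edgeMap x) (hfe h (γ : P))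
    simp only [comp_edgeMap, Function.comp_apply] at e1
    rw [hx.2 γ] at e1
    exact e1.symm
  obtain ⟨ε, hεF, hεc⟩ := exists_compatible_of_eventually_subsingleton_image
    (X := fun j => (T j).Edge) (fun i j h => (f h).edgeMap)
    (fun i j k hij hjk x => by
      have e1 := congrArg (fun φ : T k ⟶ T i => φ.edgeMap x) (f_comp hij hjk)
      simpa only [comp_edgeMap, Function.comp_apply] using e1)
    F hne hmap
    (fun j => by
      obtain ⟨i, h, hi⟩ := hstar j
      refine ⟨i, h, ?_⟩
      rintro _ ⟨e, he, rfl⟩ _ ⟨e', he', rfl⟩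
      exact hi e e' he.1 he'.1 he.2 he'.2)
  exact ⟨ε, fun j => hεF j, hεc⟩

end SemiGraph

end Literature.AnabelianGeometry.SemiGraphs
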